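import Literature.Geometry.Kaehler.ComplexTorusAnalyticHypersurfaceSectionsProper
import Literature.Geometry.Kaehler.ComplexTorusAnalyticSetsNoetherian
import HarnessLib

/-!
# Hypersurfaces meeting every positive-dimensional subvariety: the final intersection is proper iff
# every partial intersection is proper

Layer `Literature/Geometry/Kaehler`; lane `lit-hodgefound`, seat p07 (programme «INTERSECTION NUMBERS ARE
POINT COUNTS», file 30). Let `X = E/Λ` be a compact complex torus of dimension `g = q + 1`, `Y ⊆ X` closed
analytic of pure dimension `d`, and `A₀, …, A_{k−1} ⊆ X` closed analytic HYPERSURFACES (pure dimension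
`q`) with `k ≤ d` which are NUMERICALLY POSITIVE in the following sense:

  `(P)`  every irreducible closed analytic `C ⊆ X` of positive (pure) dimension meets every `A_i`

(on an abelian variety: every AMPLE divisor, since `(L^{m} · C) > 0`; Fulton, §12.2, Lange §4.6). The
properness notion of the programme (files 4, 8–11, 18–23: hypothesis `G(τ)`) is STAGEWISE — every partial
intersection `Y ∩ ⋂_{j ∈ s} A_j` is empty or of pure dimension `d − #s`. This file shows that under `(P)` it
is equivalent to properness of the FINAL intersection alone:

* §1 **`exists_subset_inter_biInter_of_forall_inter_nonempty`** — under `(P)`, an irreducible closed analytic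
  `C` of pure dimension `m ≥ #t` contains, inside `C ∩ ⋂_{j ∈ t} A_j`, an irreducible closed analytic `C'`
  of pure dimension `≥ m − #t` (cut one hypersurface at a time: the section is non-empty by `(P)` and every
  component drops dimension by at most one, [Chirka1989, §3.5 Prop. 3]).
* §2 **`forall_inter_biInter_eq_empty_or_hasPureDim_of_inter_iInter`** — if `Y ∩ ⋂_j A_j` is empty or of
  pure dimension `d − k`, then EVERY partial intersection `Y ∩ ⋂_{j ∈ s} A_j` is empty or of pure dimension
  `d − #s`: an excess component `C` of a partial intersection (`dim C > d − #s`, the only failure mode by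
  [Chirka1989, §3.5 Prop. 3 / §5.3 Cor. 1], files 22–23) would by §1 leave an irreducible piece of dimension
  `> d − k` inside the final intersection. `inter_iInter_eq_empty_or_hasPureDim_iff_forall_biInter` (the
  equivalence) and the sequential NON-CONTAINMENT criterion of file 23 read backwards:
  `forall_isIrreducibleComponent_not_subset_of_inter_iInter` (no component of `Y ∩ ⋂_{j ∈ s} A_j` lies in
  `A_i`, `i ∉ s`).
* §3 the translate form for `Z(τ) = Y ∩ ⋂_j (D_j − τ_j)` when the `D_j` satisfy `(P)` for all their
  translates (`forall_inter_biInter_translate_eq_empty_or_hasPureDim_of_inter_iInter_translate`): the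
  GENERICITY SET `G` of the programme is `{τ | Z(τ) is empty or of pure dimension d − k}`.

[Fulton1998, §12.2 (positivity: "if `V` and `W` meet, every component has the expected dimension … when
the tangent bundle is ample") and Example 12.2.1; §8.2 Example 8.2.1 (regular sequences);
Chirka1989, §3.5 Prop. 3 (p. 37), §5.3 Cor. 1 (p. 55)]. Theorems only; no definitions, no named facts.

## References

* [Chirka1989] E. M. Chirka, *Complex Analytic Sets*, Kluwer 1989, §3.5 Prop. 3 (p. 37), §5.3 Cor. 1 (p. 55),
  §5.4 Thm. (p. 57).
* [Fulton1998] W. Fulton, *Intersection Theory*, 2nd ed., Springer 1998, §7.1, §8.2 Example 8.2.1, §12.2 and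
  Example 12.2.1.
-/

open scoped Manifold Topology Pointwise
open MeasureTheory Set Function Filter Module

namespace Literature.Geometry.Kaehler
namespace ComplexTorus

universe u

variable {ι : Type*} [Fintype ι] {E : Type u} [NormedAddCommGroup E] [InnerProductSpace ℂ E]
  [FiniteDimensional ℂ E] [MeasurableSpace E] [BorelSpace E] (Φ : (ι → ℝ) ≃L[ℝ] E)

/-! ### §1 Cutting a positive-dimensional irreducible set by hypersurfaces it must meet -/

omit [MeasurableSpace E] [BorelSpace E] in
/-- **One cut**: for an irreducible closed analytic `C` of pure dimension `m + 1` and a hypersurface `A`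
meeting `C`, some irreducible closed analytic `C' ⊆ C ∩ A` has pure dimension `≥ m`.
[cite: Chirka1989, §3.5 Prop. 3 (p. 37) and §5.4 Thm. (p. 57)] -/
theorem exists_subset_inter_of_inter_nonempty {q : ℕ} (hq1 : q + 1 = finrank ℂ E)
    {C A : Set (ComplexTorus Φ)} {m : ℕ} (hC : HasPureDim 𝓘(ℂ, E) C (m + 1)) (hA : HasPureDim 𝓘(ℂ, E) A q)
    (hne : (C ∩ A).Nonempty) :
    ∃ C' m', IsIrreducibleAnalyticSet 𝓘(ℂ, E) C' ∧ HasPureDim 𝓘(ℂ, E) C' m' ∧ m ≤ m' ∧ C' ⊆ C ∩ A := by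
  obtain ⟨x, hx⟩ := hne
  have hCA : IsAnalyticSet 𝓘(ℂ, E) (C ∩ A) := hC.isAnalyticSet.inter hA.isAnalyticSet
  -- `x` lies on an irreducible component `C'` of `C ∩ A` (Chirka §5.4 Thm. (2) and Lemma)
  have hx' : x ∈ ⋃ y ∈ regularLocus 𝓘(ℂ, E) (C ∩ A),
      closure (connectedComponentIn (regularLocus 𝓘(ℂ, E) (C ∩ A)) y) := by
    rw [← IsAnalyticSet.eq_iUnion_closure_connectedComponentIn_holds 𝓘(ℂ, E) (ComplexTorus Φ) hCA]
    exact hx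
  simp only [mem_iUnion, exists_prop] at hx'
  obtain ⟨y, hy, -⟩ := hx'
  have hC' := IsAnalyticSet.isIrreducibleComponent_closure_connectedComponentIn_holds 𝓘(ℂ, E) (ComplexTorus Φ)
    hCA hy
  set C' := closure (connectedComponentIn (regularLocus 𝓘(ℂ, E) (C ∩ A)) y)
  -- dimension bound: `C ∩ A = C ∩ ⋂_{j : Fin 1} A`
  have hC'1 : IsIrreducibleComponent 𝓘(ℂ, E) (C ∩ ⋂ _j : Fin 1, A) C' := by rwa [iInter_const]
  obtain ⟨m', hm', -, hC'm'⟩ := exists_hasPureDim_of_isIrreducibleComponent_inter_iInter Φ hq1 hC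
    (D := fun _ : Fin 1 ↦ A) (fun _ ↦ hA) hC'1
  exact ⟨C', m', hC'.isIrreducibleAnalyticSet, hC'm', by omega, hC'.subset⟩

omit [MeasurableSpace E] [BorelSpace E] in
/-- **ITERATED CUTS UNDER `(P)`.** Let `A_j` (`j < k`) be hypersurfaces each meeting every irreducible closed
analytic subset of positive pure dimension. Then for every finite set `t` of indices and every irreducible
closed analytic `C` of pure dimension `m ≥ #t`, there is an irreducible closed analytic `C' ⊆ C ∩ ⋂_{j ∈ t} A_j`
of pure dimension `m' ≥ m − #t`. [cite: Chirka1989, §3.5 Prop. 3 (p. 37)]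
[cite: Fulton1998, §12.2 and Example 12.2.1] -/
theorem exists_subset_inter_biInter_of_forall_inter_nonempty {q k : ℕ} (hq1 : q + 1 = finrank ℂ E)
    {A : Fin k → Set (ComplexTorus Φ)} (hA : ∀ j, HasPureDim 𝓘(ℂ, E) (A j) q)
    (hP : ∀ j (C : Set (ComplexTorus Φ)) (m : ℕ), IsIrreducibleAnalyticSet 𝓘(ℂ, E) C →
      HasPureDim 𝓘(ℂ, E) C (m + 1) → (C ∩ A j).Nonempty)
    (t : Finset (Fin k)) :
    ∀ {C : Set (ComplexTorus Φ)} {m : ℕ}, IsIrreducibleAnalyticSet 𝓘(ℂ, E) C → HasPureDim 𝓘(ℂ, E) C m →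
      t.card ≤ m → ∃ C' m', IsIrreducibleAnalyticSet 𝓘(ℂ, E) C' ∧ HasPureDim 𝓘(ℂ, E) C' m' ∧
        m ≤ m' + t.card ∧ C' ⊆ C ∩ ⋂ j ∈ t, A j := by
  classical
  induction t using Finset.induction_on with
  | empty =>
    intro C m hCi hC _
    exact ⟨C, m, hCi, hC, by simp, by simp⟩
  | insert i t hi ih =>
    intro C m hCi hC hcard
    rw [Finset.card_insert_of_notMem hi] at hcard
    obtain ⟨C', m', hC'i, hC', hm', hsub⟩ := ih hCi hC (by omega)
    -- `C'` has positive dimension: cut it by `A i`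
    obtain ⟨m'', rfl⟩ : ∃ m'', m' = m'' + 1 := ⟨m' - 1, by omega⟩
    obtain ⟨C'', n, hC''i, hC'', hn, hsub'⟩ :=
      exists_subset_inter_of_inter_nonempty Φ hq1 hC' (hA i) (hP i C' m'' hC'i hC')
    refine ⟨C'', n, hC''i, hC'', ?_, ?_⟩
    · rw [Finset.card_insert_of_notMem hi]
      omega
    · rw [Finset.set_biInter_insert]
      intro x hx
      obtain ⟨hxC', hxA⟩ := hsub' hx
      obtain ⟨hxC, hxt⟩ := hsub hxC'
      exact ⟨hxC, hxA, hxt⟩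

/-! ### §2 Final properness implies properness of every partial intersection -/

omit [Fintype ι] [FiniteDimensional ℂ E] [MeasurableSpace E] [BorelSpace E] in
/-- Reindexing a partial intersection over a `Finset` as an intersection over `Fin #s`. [folklore] -/
private theorem biInter_finset_eq_iInter_fin {k : ℕ} (A : Fin k → Set (ComplexTorus Φ)) (s : Finset (Fin k)) :
    ⋂ j ∈ s, A j = ⋂ i : Fin s.card, A (s.orderEmbOfFin rfl i) := by
  rw [← biInter_range, Finset.range_orderEmbOfFin]
  rfl

omit [MeasurableSpace E] [BorelSpace E] in
/-- **Every component of a partial intersection `Y ∩ ⋂_{j ∈ s} A_j` has pure dimension `≥ d − #s`**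
(files 22–23, any finite set of hypersurfaces). [cite: Chirka1989, §3.5 Prop. 3 (p. 37)] -/
theorem exists_hasPureDim_of_isIrreducibleComponent_inter_biInter {q k d : ℕ} (hq1 : q + 1 = finrank ℂ E)
    {Y : Set (ComplexTorus Φ)} (hY : HasPureDim 𝓘(ℂ, E) Y d) {A : Fin k → Set (ComplexTorus Φ)}
    (hA : ∀ j, HasPureDim 𝓘(ℂ, E) (A j) q) (s : Finset (Fin k)) {C : Set (ComplexTorus Φ)}
    (hC : IsIrreducibleComponent 𝓘(ℂ, E) (Y ∩ ⋂ j ∈ s, A j) C) :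
    ∃ m, d ≤ m + s.card ∧ m ≤ finrank ℂ E ∧ HasPureDim 𝓘(ℂ, E) C m := by
  rw [biInter_finset_eq_iInter_fin] at hC
  exact exists_hasPureDim_of_isIrreducibleComponent_inter_iInter Φ hq1 hY (fun i ↦ hA _) hC

omit [MeasurableSpace E] [BorelSpace E] in
/-- **FINAL PROPERNESS ⇒ STAGEWISE PROPERNESS under `(P)`.** Let `Y` have pure dimension `d`, `A_j` (`j < k`,
`k ≤ d`) hypersurfaces satisfying `(P)`. If `Y ∩ ⋂_j A_j` is empty or of pure dimension `d − k`, then for every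
finite set `s` of indices `Y ∩ ⋂_{j ∈ s} A_j` is empty or of pure dimension `d − #s`.
[cite: Fulton1998, §12.2 and Example 12.2.1, §8.2 Example 8.2.1]
[cite: Chirka1989, §3.5 Prop. 3 (p. 37) and §5.3 Cor. 1 (p. 55)] -/
theorem forall_inter_biInter_eq_empty_or_hasPureDim_of_inter_iInter {q k d : ℕ} (hq1 : q + 1 = finrank ℂ E)
    {Y : Set (ComplexTorus Φ)} (hY : HasPureDim 𝓘(ℂ, E) Y d) {A : Fin k → Set (ComplexTorus Φ)}
    (hA : ∀ j, HasPureDim 𝓘(ℂ, E) (A j) q) (hkd : k ≤ d)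
    (hP : ∀ j (C : Set (ComplexTorus Φ)) (m : ℕ), IsIrreducibleAnalyticSet 𝓘(ℂ, E) C →
      HasPureDim 𝓘(ℂ, E) C (m + 1) → (C ∩ A j).Nonempty)
    (hfin : Y ∩ ⋂ j, A j = ∅ ∨ HasPureDim 𝓘(ℂ, E) (Y ∩ ⋂ j, A j) (d - k)) (s : Finset (Fin k)) :
    Y ∩ ⋂ j ∈ s, A j = ∅ ∨ HasPureDim 𝓘(ℂ, E) (Y ∩ ⋂ j ∈ s, A j) (d - s.card) := by
  classical
  by_cases hempty : Y ∩ ⋂ j ∈ s, A j = ∅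
  · exact Or.inl hempty
  right
  have hW : IsAnalyticSet 𝓘(ℂ, E) (Y ∩ ⋂ j ∈ s, A j) :=
    hY.isAnalyticSet.inter (isAnalyticSet_biInter_finset s fun j _ ↦ (hA j).isAnalyticSet)
  refine hasPureDim_of_forall_isIrreducibleComponent Φ hW (nonempty_iff_ne_empty.2 hempty) fun C hC ↦ ?_
  -- a component `C` of the partial intersection, of pure dimension `m ≥ d − #s`
  obtain ⟨m, hdm, -, hCm⟩ := exists_hasPureDim_of_isIrreducibleComponent_inter_biInter Φ hq1 hY hA s hC
  by_contra hne
  have hlt : d - s.card < m := by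
    rcases (show d - s.card ≤ m by omega).eq_or_lt with h | h
    · exact absurd (h ▸ hCm) hne
    · exact h
  -- cut `C` by the remaining hypersurfaces `A_j`, `j ∉ s`
  have hscard : s.card ≤ k := by simpa using s.card_le_univ
  have hccard : sᶜ.card = k - s.card := by rw [Finset.card_compl, Fintype.card_fin]
  obtain ⟨C', m', hC'i, hC', hm', hsub⟩ := exists_subset_inter_biInter_of_forall_inter_nonempty Φ hq1 hA hP sᶜ
    hC.isIrreducibleAnalyticSet hCm (by omega)
  -- `C'` lies in the final intersection and has dimension `> d − k`
  have hsub' : C' ⊆ Y ∩ ⋂ j, A j := by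
    intro x hx
    obtain ⟨hxC, hxc⟩ := hsub hx
    obtain ⟨hxY, hxs⟩ := hC.subset hxC
    refine ⟨hxY, mem_iInter.2 fun j ↦ ?_⟩
    by_cases hj : j ∈ s
    · exact (mem_iInter₂.1 hxs) j hj
    · exact (mem_iInter₂.1 hxc) j (Finset.mem_compl.2 hj)
  rcases hfin with h0 | hpure
  · exact hC'.nonempty.ne_empty (eq_empty_of_subset_empty (h0 ▸ hsub'))
  · have hle := le_of_subset_of_hasPureDim Φ hpure hC' hsub'
    omega

omit [MeasurableSpace E] [BorelSpace E] in
/-- **THE EQUIVALENCE under `(P)`** (`k ≤ d`): `Y ∩ ⋂_j A_j` is empty or of pure dimension `d − k` iff every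
partial intersection `Y ∩ ⋂_{j ∈ s} A_j` is empty or of pure dimension `d − #s`.
[cite: Fulton1998, §12.2 and Example 12.2.1, §8.2 Example 8.2.1] [cite: Chirka1989, §3.5 Prop. 3 (p. 37)] -/
theorem inter_iInter_eq_empty_or_hasPureDim_iff_forall_biInter {q k d : ℕ} (hq1 : q + 1 = finrank ℂ E)
    {Y : Set (ComplexTorus Φ)} (hY : HasPureDim 𝓘(ℂ, E) Y d) {A : Fin k → Set (ComplexTorus Φ)}
    (hA : ∀ j, HasPureDim 𝓘(ℂ, E) (A j) q) (hkd : k ≤ d)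
    (hP : ∀ j (C : Set (ComplexTorus Φ)) (m : ℕ), IsIrreducibleAnalyticSet 𝓘(ℂ, E) C →
      HasPureDim 𝓘(ℂ, E) C (m + 1) → (C ∩ A j).Nonempty) :
    (Y ∩ ⋂ j, A j = ∅ ∨ HasPureDim 𝓘(ℂ, E) (Y ∩ ⋂ j, A j) (d - k)) ↔
      ∀ s : Finset (Fin k), Y ∩ ⋂ j ∈ s, A j = ∅ ∨ HasPureDim 𝓘(ℂ, E) (Y ∩ ⋂ j ∈ s, A j) (d - s.card) := by
  refine ⟨fun h s ↦ forall_inter_biInter_eq_empty_or_hasPureDim_of_inter_iInter Φ hq1 hY hA hkd hP h s, fun h ↦ ?_⟩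
  have hu := h Finset.univ
  simpa only [Finset.mem_univ, iInter_true, Finset.card_univ, Fintype.card_fin] using hu

omit [MeasurableSpace E] [BorelSpace E] in
/-- **FINAL PROPERNESS ⇒ THE NON-CONTAINMENT CRITERION `G`** (file 23 read backwards): under `(P)` and
`k ≤ d`, if `Y ∩ ⋂_j A_j` is empty or of pure dimension `d − k`, then for every `s` and `i ∉ s` no irreducible
component of `Y ∩ ⋂_{j ∈ s} A_j` is contained in `A_i`. [cite: Chirka1989, §5.3 Cor. 1 (p. 55)]
[cite: Fulton1998, §8.2 Example 8.2.1 and §12.2] -/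
theorem forall_isIrreducibleComponent_not_subset_of_inter_iInter {q k d : ℕ} (hq1 : q + 1 = finrank ℂ E)
    {Y : Set (ComplexTorus Φ)} (hY : HasPureDim 𝓘(ℂ, E) Y d) {A : Fin k → Set (ComplexTorus Φ)}
    (hA : ∀ j, HasPureDim 𝓘(ℂ, E) (A j) q) (hkd : k ≤ d)
    (hP : ∀ j (C : Set (ComplexTorus Φ)) (m : ℕ), IsIrreducibleAnalyticSet 𝓘(ℂ, E) C →
      HasPureDim 𝓘(ℂ, E) C (m + 1) → (C ∩ A j).Nonempty)
    (hfin : Y ∩ ⋂ j, A j = ∅ ∨ HasPureDim 𝓘(ℂ, E) (Y ∩ ⋂ j, A j) (d - k))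
    (s : Finset (Fin k)) {i : Fin k} (hi : i ∉ s) (C : Set (ComplexTorus Φ))
    (hC : IsIrreducibleComponent 𝓘(ℂ, E) (Y ∩ ⋂ j ∈ s, A j) C) : ¬ C ⊆ A i := by
  classical
  have hs := forall_inter_biInter_eq_empty_or_hasPureDim_of_inter_iInter Φ hq1 hY hA hkd hP hfin s
  have hsi := forall_inter_biInter_eq_empty_or_hasPureDim_of_inter_iInter Φ hq1 hY hA hkd hP hfin (insert i s)
  have hset : Y ∩ ⋂ j ∈ insert i s, A j = (Y ∩ ⋂ j ∈ s, A j) ∩ A i := by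
    rw [Finset.set_biInter_insert, ← inter_assoc, inter_right_comm]
  have hscard : s.card < k := by
    have := Finset.card_lt_card (Finset.ssubset_insert hi)
    have h2 : (insert i s).card ≤ k := by simpa using (insert i s).card_le_univ
    omega
  rw [hset, Finset.card_insert_of_notMem hi] at hsi
  rcases hs with h0 | hpure
  · -- the partial intersection is empty: it has no components
    exact fun _ ↦ hC.nonempty.ne_empty (eq_empty_of_subset_empty (h0 ▸ hC.subset))
  · obtain ⟨r, hr⟩ : ∃ r, d - s.card = r + 1 := ⟨d - s.card - 1, by omega⟩
    rw [hr] at hpure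
    rw [show d - (s.card + 1) = r by omega] at hsi
    exact forall_isIrreducibleComponent_not_subset_of_inter_eq_empty_or_hasPureDim Φ hpure (hA i) hsi C hC

/-! ### §3 The translate form: the genericity set of the programme under `(P)` -/

omit [MeasurableSpace E] [BorelSpace E] in
/-- **`Z(τ)` PROPER ⇔ ALL STAGES PROPER**, for hypersurfaces `D_j` all of whose translates satisfy `(P)`: for
`τ ∈ X^k` (`k ≤ d`), `Y ∩ ⋂_j (D_j − τ_j)` is empty or of pure dimension `d − k` iff every
`Y ∩ ⋂_{j ∈ s} (D_j − τ_j)` is empty or of pure dimension `d − #s` — the genericity hypothesis `G(τ)` of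
`ComplexTorusAnalyticIteratedTranslatesProper` and files 4, 8–11, 18–23.
[cite: Fulton1998, §12.2 and Example 12.2.1, Example 11.4.5] [cite: Chirka1989, §3.5 Prop. 3 (p. 37)] -/
theorem inter_iInter_translate_eq_empty_or_hasPureDim_iff_forall_biInter {q k d : ℕ} (hq1 : q + 1 = finrank ℂ E)
    {Y : Set (ComplexTorus Φ)} (hY : HasPureDim 𝓘(ℂ, E) Y d) {D : Fin k → Set (ComplexTorus Φ)}
    (hD : ∀ j, HasPureDim 𝓘(ℂ, E) (D j) q) (hkd : k ≤ d)
    (hP : ∀ j (C : Set (ComplexTorus Φ)) (m : ℕ), IsIrreducibleAnalyticSet 𝓘(ℂ, E) C →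
      HasPureDim 𝓘(ℂ, E) C (m + 1) → ∀ t : ComplexTorus Φ, (C ∩ (t +ᵥ D j)).Nonempty)
    (τ : Fin k → ComplexTorus Φ) :
    (Y ∩ ⋂ j, (fun x ↦ x + τ j) ⁻¹' D j = ∅ ∨
        HasPureDim 𝓘(ℂ, E) (Y ∩ ⋂ j, (fun x ↦ x + τ j) ⁻¹' D j) (d - k)) ↔
      ∀ s : Finset (Fin k), Y ∩ ⋂ j ∈ s, (fun x ↦ x + τ j) ⁻¹' D j = ∅ ∨
        HasPureDim 𝓘(ℂ, E) (Y ∩ ⋂ j ∈ s, (fun x ↦ x + τ j) ⁻¹' D j) (d - s.card) := by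
  have hpre : ∀ j, (fun x ↦ x + τ j) ⁻¹' D j = -τ j +ᵥ D j := by
    intro j
    ext x
    rw [mem_preimage, Set.mem_vadd_set_iff_neg_vadd_mem, neg_neg, vadd_eq_add, add_comm]
  refine inter_iInter_eq_empty_or_hasPureDim_iff_forall_biInter Φ hq1 hY
    (fun j ↦ hasPureDim_preimage_add_right Φ (hD j) (τ j)) hkd fun j C m hCi hC ↦ ?_
  rw [hpre]
  exact hP j C m hCi hC (-τ j)

omit [MeasurableSpace E] [BorelSpace E] in
/-- … and then the non-containment criterion holds at every stage: no component of
`Y ∩ ⋂_{j ∈ s} (D_j − τ_j)` lies in `D_i − τ_i` (`i ∉ s`). [cite: Chirka1989, §5.3 Cor. 1 (p. 55)]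
[cite: Fulton1998, §8.2 Example 8.2.1, Example 11.4.5 and §12.2] -/
theorem forall_isIrreducibleComponent_not_subset_of_inter_iInter_translate {q k d : ℕ}
    (hq1 : q + 1 = finrank ℂ E) {Y : Set (ComplexTorus Φ)} (hY : HasPureDim 𝓘(ℂ, E) Y d)
    {D : Fin k → Set (ComplexTorus Φ)} (hD : ∀ j, HasPureDim 𝓘(ℂ, E) (D j) q) (hkd : k ≤ d)
    (hP : ∀ j (C : Set (ComplexTorus Φ)) (m : ℕ), IsIrreducibleAnalyticSet 𝓘(ℂ, E) C →
      HasPureDim 𝓘(ℂ, E) C (m + 1) → ∀ t : ComplexTorus Φ, (C ∩ (t +ᵥ D j)).Nonempty)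
    (τ : Fin k → ComplexTorus Φ)
    (hfin : Y ∩ ⋂ j, (fun x ↦ x + τ j) ⁻¹' D j = ∅ ∨
      HasPureDim 𝓘(ℂ, E) (Y ∩ ⋂ j, (fun x ↦ x + τ j) ⁻¹' D j) (d - k))
    (s : Finset (Fin k)) {i : Fin k} (hi : i ∉ s) (C : Set (ComplexTorus Φ))
    (hC : IsIrreducibleComponent 𝓘(ℂ, E) (Y ∩ ⋂ j ∈ s, (fun x ↦ x + τ j) ⁻¹' D j) C) :
    ¬ C ⊆ (fun x ↦ x + τ i) ⁻¹' D i := by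
  have hpre : ∀ j, (fun x ↦ x + τ j) ⁻¹' D j = -τ j +ᵥ D j := by
    intro j
    ext x
    rw [mem_preimage, Set.mem_vadd_set_iff_neg_vadd_mem, neg_neg, vadd_eq_add, add_comm]
  refine forall_isIrreducibleComponent_not_subset_of_inter_iInter Φ hq1 hY
    (fun j ↦ hasPureDim_preimage_add_right Φ (hD j) (τ j)) hkd (fun j C m hCi hC ↦ ?_) hfin s hi C hC
  rw [hpre]
  exact hP j C m hCi hC (-τ j)

end ComplexTorus

end Literature.Geometry.Kaehler
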